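import Summits.QuantumFields.YangMills.Theses.XiPowWidening
import Literature.MathematicalPhysics.QuantumLattice.LatticeGaugeDLRGibbsProofs
import Literature.MathematicalPhysics.QuantumFieldTheory.Balaban1983to89.InfiniteVolumeSufficientIV

/-!
# Route `XiPowWidening` (QuantumFields / YangMills; closes the rung-R2ξ leaf `WeakCouplingRates.XiPow` for every compact simple `G`)
# — SUPPORT ITEM `LimitPointsAreInvariantDLRG` (stmt-QuantumFields-22468), PROVED

Proof authored by the planner-of-record ym-idea-1 g0 (birth-certificate artefact `bc/XiPowWidening_supports.lean`, 2026-08-27,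
lean check rc 0 · 0 sorry); landed verbatim by width seat `ym-line-sfw-p2-w2` g3 (the ideator seat cannot propose).
For every compact simple `G`, faithful lattice representation `r`, inverse coupling `β`: every infinite-volume torus limit point
of the 4-d Wilson theory is a DLR state for `ymSpecification r.ρ β` (Georgii Thm 4.17, tree
`mem_ymGibbsMeasures_of_mem_infiniteVolumeLimitPoints_holds`) and is `ℤ⁴`-translation invariant (tree
`isZdTranslationInvariant_of_mem_infiniteVolumeLimitPoints`); the only work is to derive `T2Space G` and
`SecondCountableTopology G` from the faithful finite-dimensional representation (`T2Space.of_injective_continuous`,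
closed embedding ⇒ second countable).

WHAT THIS IS NOT: not a proof of the route's cruxes `CorrelatorRigidityG` (stmt-QuantumFields-22466) or `WitnessStateFloorG`
(stmt-QuantumFields-22467); not a mass gap; no summit is proved (the route bears on the RECORD rung R2ξ `XiPow`, an ANTI-gap
statement `m ≤ β^(−ε)`).
-/

noncomputable section

namespace Summit.QuantumFields.YangMills.Theorems

open MeasureTheory Filter Topology
open Literature.MathematicalPhysics.QuantumFieldTheory
open Literature.MathematicalPhysics.QuantumLattice
open Summit.QuantumFields.YangMills.Theorems.WeakCouplingRates
open Summit.QuantumFields.YangMills.Theses.XiPowWidening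

/-- **SUPPORT ITEM stmt-QuantumFields-22468 OF ROUTE `XiPowWidening`, PROVED**: for every compact simple `G`, `r`, `β`, every
infinite-volume torus limit point is a DLR state for `ymSpecification r.ρ β` and is `ℤ⁴`-translation invariant (Georgii 4.17 +
translation invariance of torus limit points, both tree facts once `T2Space`/`SecondCountableTopology G` come from the faithful
representation). [cite: Georgii2011, Thm 4.17] -/
theorem xiPowWidening_limitPointsAreInvariantDLRG_proof :
    Summit.QuantumFields.YangMills.Theses.XiPowWidening.LimitPointsAreInvariantDLRG := by
  intro G _ _ _ _ hG
  letI : MeasurableSpace G := borel G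
  haveI : BorelSpace G := ⟨rfl⟩
  intro r β μ hμ
  haveI : T2Space G := T2Space.of_injective_continuous r.injective r.continuous
  haveI : SecondCountableTopology G :=
    (r.continuous.isClosedEmbedding r.injective).isEmbedding.secondCountableTopology
  exact ⟨mem_ymGibbsMeasures_of_mem_infiniteVolumeLimitPoints_holds (d := 4) r.ρ r.continuous hμ,
    isZdTranslationInvariant_of_mem_infiniteVolumeLimitPoints (d := 4) r.ρ hμ⟩

end Summit.QuantumFields.YangMills.Theorems

end
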